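/-
Copyright (c) 2026 the pub-hodgecm-mathlib formalisation cell (harness21).  Prover seat hodgecm-mathlib-K2E3-p11 (g5), Track B «K2-LIT» ∕ h413
(`stmt-HodgeConjecture-24833`), line `K2_E3_EllipticInputs`, unit U12 §L, Richardson road for (LBGL-ge3) at `N = 3` (road owner K2E3-p11), brick (F-E) =
(LBGL-3E) «THE (2,1)-PARABOLIC SLICE DENSITY OF 𝔤𝔩₃(F)», FILE H″3a «PIECE TRANSPORT BY A PERMUTATION MATRIX and the level sets of the three fibre pieces».
2026-09-04.
-/
import Summits.HodgeConjecture.HodgeConjecture.Theorems.K2E3GLnLieAdIntegralInvariant       -- ★ (K2E3-p12): `lintegral_comp_conj_of_mem_glInt` (`Ad(k)`, `k ∈ GL₃(𝒪)`, preserves `μ𝔤`)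
import Literature.NumberTheory.Automorphic.HeckeTransversalGL                                -- ★ `mem_glInt_of_isIntegralMatrix`
import Literature.NumberTheory.Automorphic.AddCharConductorExponent                          -- ★ `primePowBall` kit
import Mathlib.MeasureTheory.Group.LIntegral
import HarnessLib

/-!
# K2_E3 road (h413), §L ∕ Richardson road at `N = 3`, brick (F-E) FILE H″3a: piece transport by a permutation matrix; the level sets of the fibre pieces

Cell `pub/hodgecm-mathlib` (D-0151), Track B, seat K2E3-p11 (g5) (road owner of (F-E) = (LBGL-3E) `sig_K2E3GL3ParabolicSliceDensity`; ROAD v2 on `K2/STATUS.md`,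
2026-09-04).  `--supports stmt-HodgeConjecture-24833 --as helper`; THEOREMS ONLY (no definition ∕ instance ∕ notation ∕ named fact ∕ `sorry`); never imports
`Cruxes/…/Lines`.  COUNT-NEUTRAL.

THE POINT.  At a split regular point `diag(d)` (`d` injective) the fibre of `K × 𝔭 → 𝔤𝔩₃` has THREE pieces, indexed by the row `a ∈ {0,1,2}` of `k` whose first two entries
are deep (★ EXHAUST (b)).  The piece `a` is carried to the standard piece `a = 2` by LEFT multiplication with a permutation matrix `w ∈ GL₃(𝒪)` exchanging rows `a`
and `2`: `κ` is left-invariant, `Ad(w)` permutes the entries of `𝔤𝔩₃` (so it maps the ball `diag(d∘σ) + M₃(𝔭^J)` onto `diag(d) + M₃(𝔭^J)`) and preserves `μ𝔤` (★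
`lintegral_comp_conj_of_mem_glInt`).  Hence every piece is a BALL PIECE of ★ H″1 at the permuted Levi datum, with weight `‖∏_{l ≠ a}(d_a − d_l)‖⁻¹`:
* §1 `det_notMem_primePowBall_one_of_mem_glInt`, `not_two_rows_deep_of_mem_glInt` (two different rows of `k ∈ GL₃(𝒪)` cannot both be `≡ (0,0,*) mod 𝔭`);
* §2 **`lintegral_levelSet_row_eq_of_transport`** — the transport identity for ONE piece, the ball-piece formula entering as the HYPOTHESIS `hball` (constant `C` shared);
* §3 the two permutation matrices `W₀ = [[0,0,1],[0,1,0],[1,0,0]]`, `W₁ = [[1,0,0],[0,0,1],[0,1,0]]`: membership in `GL₃(𝒪)`, the row identity, the conjugation identity.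
FILE H″3b assembles the three pieces into the local density at `diag(d)`.
[HarishChandra1999AdmissibleDistributions, §7 Lemma 7.8] [HarishChandra1970, Part V §4 Lemma 22]
HONEST LABEL: HC_CM is proved only modulo the 7 printed citations (2 remaining named inputs: hLiu418 = stmt-HodgeConjecture-24832, h413 = stmt-HodgeConjecture-24833)
until rung 0 closes; count-neutral helper ((LBGL-ge3)∕(LBGL-3E) NOT ★ here).

## References
* [HarishChandra1999AdmissibleDistributions] Harish-Chandra (DeBacker–Sally), *Admissible Invariant Distributions on Reductive p-adic Groups* (1999), §7, Lemma 7.8.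
* [HarishChandra1970] Harish-Chandra (van Dijk), *Harmonic Analysis on Reductive p-adic Groups*, LNM 162 (1970), Part V §4 Lemma 22.
-/

set_option autoImplicit false
set_option linter.dupNamespace false

noncomputable section

open MeasureTheory Measure Filter Topology Set Matrix ValuativeRel
open scoped MatrixGroups NNReal ENNReal
open Literature.NumberTheory.Automorphic Literature.NumberTheory.Automorphic.LocalFieldHaar
open Literature.NumberTheory.GaloisRepresentations Literature.NumberTheory.GaloisRepresentations.IsNonarchimedeanLocalField

namespace Summit.HodgeConjecture.HodgeConjecture.Cruxes.H413.K2E3GL3ParabolicSlicePieceTransport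

/-! ## §1  Two different rows of an element of `GL₃(𝒪)` cannot both be deep -/

section Rows

variable {F : Type*} [Field F] [ValuativeRel F] [TopologicalSpace F] [IsNonarchimedeanLocalField F]

/-- For `k ∈ GL₃(𝒪)`, `det k ∉ 𝔭`: `det k · det k⁻¹ = 1` with both factors integral. [folklore] -/
theorem det_notMem_primePowBall_one_of_mem_glInt {k : GL (Fin 3) F} (hk : k ∈ glInt 3 F) :
    ((k : Matrix (Fin 3) (Fin 3) F)).det ∉ primePowBall F 1 := by
  intro h
  obtain ⟨hint, hint'⟩ := (mem_glInt_iff k).1 hk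
  have hdet' : ((k⁻¹ : GL (Fin 3) F) : Matrix (Fin 3) (Fin 3) F).det ∈ 𝒪[F] := IsIntegralMatrix.det_mem (fun i j => hint' i j)
  have hprod : ((k : Matrix (Fin 3) (Fin 3) F)).det * ((k⁻¹ : GL (Fin 3) F) : Matrix (Fin 3) (Fin 3) F).det = 1 := by
    rw [← Matrix.det_mul, ← Units.val_mul, mul_inv_cancel, Units.val_one, Matrix.det_one]
  have h1 : normAbs F (((k : Matrix (Fin 3) (Fin 3) F)).det * ((k⁻¹ : GL (Fin 3) F) : Matrix (Fin 3) (Fin 3) F).det) = 1 := by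
    rw [hprod, map_one]
  rw [map_mul] at h1
  have hle : normAbs F (((k⁻¹ : GL (Fin 3) F) : Matrix (Fin 3) (Fin 3) F).det) ≤ 1 := normAbs_le_one_iff.2 hdet'
  have hlt : normAbs F ((k : Matrix (Fin 3) (Fin 3) F)).det < 1 := by
    have h' := mem_primePowBall_iff.1 h
    rw [zpow_one] at h'
    exact lt_of_le_of_lt h' inv_residueFieldCard_lt_one
  have : normAbs F (((k : Matrix (Fin 3) (Fin 3) F)).det) * normAbs F (((k⁻¹ : GL (Fin 3) F) : Matrix (Fin 3) (Fin 3) F).det) < 1 := by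
    calc normAbs F (((k : Matrix (Fin 3) (Fin 3) F)).det) * normAbs F (((k⁻¹ : GL (Fin 3) F) : Matrix (Fin 3) (Fin 3) F).det)
        ≤ normAbs F (((k : Matrix (Fin 3) (Fin 3) F)).det) * 1 := mul_le_mul_of_nonneg_left hle zero_le
      _ < 1 := by rw [mul_one]; exact hlt
  exact absurd h1 this.ne

/-- The `3 × 3` determinant lies in `𝔭` when two rows (all rows but `c`) have their first two entries in `𝔭` (all entries integral): every term of the Leibniz
expansion has a factor from those four entries. [folklore] -/
theorem det_mem_primePowBall_one_of_two_rows {k : Matrix (Fin 3) (Fin 3) F} (hk : ∀ i l, k i l ∈ 𝒪[F]) (c : Fin 3)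
    (h : ∀ i, i ≠ c → k i 0 ∈ primePowBall F 1 ∧ k i 1 ∈ primePowBall F 1) : k.det ∈ primePowBall F 1 := by
  have hI : ∀ i l, k i l ∈ primePowBall F 0 := fun i l => mem_primePowBall_zero_iff.2 (hk i l)
  have hm : ∀ {x y : F} {a b : ℤ}, x ∈ primePowBall F a → y ∈ primePowBall F b → x * y ∈ primePowBall F (a + b) := fun hx hy => mul_mem_primePowBall hx hy
  have hs : ∀ {x y : F}, x ∈ primePowBall F 1 → y ∈ primePowBall F 1 → x - y ∈ primePowBall F 1 := fun hx hy => by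
    rw [sub_eq_add_neg]; exact add_mem_primePowBall hx (neg_mem_primePowBall hy)
  rw [Matrix.det_fin_three]
  fin_cases c
  · obtain ⟨h10, h11⟩ := h 1 (by decide)
    obtain ⟨h20, h21⟩ := h 2 (by decide)
    have t1 : k 0 0 * k 1 1 * k 2 2 ∈ primePowBall F 1 := by simpa using hm (hm (hI 0 0) h11) (hI 2 2)
    have t2 : k 0 0 * k 1 2 * k 2 1 ∈ primePowBall F 1 := by simpa using hm (hm (hI 0 0) (hI 1 2)) h21
    have t3 : k 0 1 * k 1 0 * k 2 2 ∈ primePowBall F 1 := by simpa using hm (hm (hI 0 1) h10) (hI 2 2)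
    have t4 : k 0 1 * k 1 2 * k 2 0 ∈ primePowBall F 1 := by simpa using hm (hm (hI 0 1) (hI 1 2)) h20
    have t5 : k 0 2 * k 1 0 * k 2 1 ∈ primePowBall F 1 := by simpa using hm (hm (hI 0 2) h10) (hI 2 1)
    have t6 : k 0 2 * k 1 1 * k 2 0 ∈ primePowBall F 1 := by simpa using hm (hm (hI 0 2) h11) (hI 2 0)
    exact hs (add_mem_primePowBall (add_mem_primePowBall (hs (hs t1 t2) t3) t4) t5) t6
  · obtain ⟨h00, h01⟩ := h 0 (by decide)
    obtain ⟨h20, h21⟩ := h 2 (by decide)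
    have t1 : k 0 0 * k 1 1 * k 2 2 ∈ primePowBall F 1 := by simpa using hm (hm h00 (hI 1 1)) (hI 2 2)
    have t2 : k 0 0 * k 1 2 * k 2 1 ∈ primePowBall F 1 := by simpa using hm (hm h00 (hI 1 2)) (hI 2 1)
    have t3 : k 0 1 * k 1 0 * k 2 2 ∈ primePowBall F 1 := by simpa using hm (hm h01 (hI 1 0)) (hI 2 2)
    have t4 : k 0 1 * k 1 2 * k 2 0 ∈ primePowBall F 1 := by simpa using hm (hm h01 (hI 1 2)) (hI 2 0)
    have t5 : k 0 2 * k 1 0 * k 2 1 ∈ primePowBall F 1 := by simpa using hm (hm (hI 0 2) (hI 1 0)) h21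
    have t6 : k 0 2 * k 1 1 * k 2 0 ∈ primePowBall F 1 := by simpa using hm (hm (hI 0 2) (hI 1 1)) h20
    exact hs (add_mem_primePowBall (add_mem_primePowBall (hs (hs t1 t2) t3) t4) t5) t6
  · obtain ⟨h00, h01⟩ := h 0 (by decide)
    obtain ⟨h10, h11⟩ := h 1 (by decide)
    have t1 : k 0 0 * k 1 1 * k 2 2 ∈ primePowBall F 1 := by simpa using hm (hm h00 (hI 1 1)) (hI 2 2)
    have t2 : k 0 0 * k 1 2 * k 2 1 ∈ primePowBall F 1 := by simpa using hm (hm h00 (hI 1 2)) (hI 2 1)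
    have t3 : k 0 1 * k 1 0 * k 2 2 ∈ primePowBall F 1 := by simpa using hm (hm h01 (hI 1 0)) (hI 2 2)
    have t4 : k 0 1 * k 1 2 * k 2 0 ∈ primePowBall F 1 := by simpa using hm (hm h01 (hI 1 2)) (hI 2 0)
    have t5 : k 0 2 * k 1 0 * k 2 1 ∈ primePowBall F 1 := by simpa using hm (hm (hI 0 2) h10) (hI 2 1)
    have t6 : k 0 2 * k 1 1 * k 2 0 ∈ primePowBall F 1 := by simpa using hm (hm (hI 0 2) h11) (hI 2 0)
    exact hs (add_mem_primePowBall (add_mem_primePowBall (hs (hs t1 t2) t3) t4) t5) t6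

/-- **Two different rows of `k ∈ GL₃(𝒪)` cannot both have their first two entries in `𝔭`** (else `det k ∈ 𝔭`). [folklore] -/
theorem not_two_rows_deep_of_mem_glInt {k : GL (Fin 3) F} (hk : k ∈ glInt 3 F) {a b : Fin 3} (hab : a ≠ b)
    (ha0 : (k : Matrix (Fin 3) (Fin 3) F) a 0 ∈ primePowBall F 1) (ha1 : (k : Matrix (Fin 3) (Fin 3) F) a 1 ∈ primePowBall F 1)
    (hb0 : (k : Matrix (Fin 3) (Fin 3) F) b 0 ∈ primePowBall F 1) (hb1 : (k : Matrix (Fin 3) (Fin 3) F) b 1 ∈ primePowBall F 1) : False := by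
  have hint : ∀ i l, (k : Matrix (Fin 3) (Fin 3) F) i l ∈ 𝒪[F] := ((mem_glInt_iff k).1 hk).1
  apply det_notMem_primePowBall_one_of_mem_glInt hk
  -- the free row `c ∉ {a, b}`
  obtain ⟨c, hc⟩ : ∃ c : Fin 3, ∀ i, i ≠ c → i = a ∨ i = b := by
    fin_cases a <;> fin_cases b
    all_goals first | exact absurd rfl hab | exact ⟨0, by decide⟩ | exact ⟨1, by decide⟩ | exact ⟨2, by decide⟩
  refine det_mem_primePowBall_one_of_two_rows hint c fun i hi => ?_
  rcases hc i hi with rfl | rfl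
  · exact ⟨ha0, ha1⟩
  · exact ⟨hb0, hb1⟩

end Rows

/-! ## §2  Piece transport by an element of `GL₃(𝒪)` exchanging rows -/

section Transport

variable {F : Type*} [Field F] [ValuativeRel F] [TopologicalSpace F] [IsNonarchimedeanLocalField F]
  [MeasurableSpace F] [BorelSpace F]
  [MeasurableSpace (Matrix (Fin 3) (Fin 3) F)] [BorelSpace (Matrix (Fin 3) (Fin 3) F)]
  [MeasurableSpace (GL (Fin 3) F)] [BorelSpace (GL (Fin 3) F)]

omit [MeasurableSpace (Matrix (Fin 3) (Fin 3) F)] [BorelSpace (Matrix (Fin 3) (Fin 3) F)] in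
/-- The row-`a` level set `{k ∈ GL₃(𝒪) | k_{a0}, k_{a1} ∈ 𝔭^{j}}` is measurable. [folklore] -/
theorem measurableSet_rowLevelSet (a : Fin 3) (j : ℕ) :
    MeasurableSet {k : ↥(glInt 3 F) | ((k : GL (Fin 3) F) : Matrix (Fin 3) (Fin 3) F) a 0 ∈ primePowBall F j ∧
      ((k : GL (Fin 3) F) : Matrix (Fin 3) (Fin 3) F) a 1 ∈ primePowBall F j} := by
  have hc : Continuous fun k : ↥(glInt 3 F) => ((k : GL (Fin 3) F) : Matrix (Fin 3) (Fin 3) F) :=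
    Units.continuous_val.comp continuous_subtype_val
  exact ((measurableSet_primePowBall (F := F) _).preimage (hc.matrix_elem a 0).measurable).inter
    ((measurableSet_primePowBall (F := F) _).preimage (hc.matrix_elem a 1).measurable)

omit [MeasurableSpace (GL (Fin 3) F)] [BorelSpace (GL (Fin 3) F)] in
/-- The ball `{X | X − M ∈ M₃(𝔭^J)}` is measurable. [folklore] -/
theorem measurableSet_subBall (M : Matrix (Fin 3) (Fin 3) F) (J : ℤ) :
    MeasurableSet {X : Matrix (Fin 3) (Fin 3) F | ∀ i l, (X - M) i l ∈ primePowBall F J} := by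
  haveI : IsTopologicalRing F := inferInstance
  have hcont : Continuous fun X : Matrix (Fin 3) (Fin 3) F => X - M := continuous_id.sub continuous_const
  have : {X : Matrix (Fin 3) (Fin 3) F | ∀ i l, (X - M) i l ∈ primePowBall F J} =
      ⋂ i, ⋂ l, (fun X : Matrix (Fin 3) (Fin 3) F => (X - M) i l) ⁻¹' primePowBall F J := by
    ext X; simp only [Set.mem_setOf_eq, Set.mem_iInter, Set.mem_preimage]
  rw [this]
  exact MeasurableSet.iInter fun i => MeasurableSet.iInter fun l =>
    (isClosed_primePowBall (F := F) J).measurableSet.preimage (hcont.matrix_elem i l).measurable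

/-- **PIECE TRANSPORT.**  Let `w ∈ GL₃(𝒪)` move row `2` to row `a` (`(w k)_{aℓ} = k₂ₗ`) and conjugate the ball at `M(m')` onto the ball at `diag(d)`
(`Ad(w)(X) − diag d ∈ M₃(𝔭^J) ↔ X − M(m') ∈ M₃(𝔭^J)`), and let the BALL PIECE FORMULA `hball` hold with constant `C` (★ H″1).  Then the row-`a` piece of
`ρ(1_{B_J(diag d)}·h)` is `C · ‖χ(m')‖⁻¹ · ∫⁻_{B_J(diag d)} h dμ𝔤` for deep `J` (`κ` left-invariant under `w`; `Ad(w)` preserves `μ𝔤`, ★ `lintegral_comp_conj_of_mem_glInt`).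
[cite: HarishChandra1999AdmissibleDistributions, §7 Lemma 7.8] -/
theorem lintegral_levelSet_row_eq_of_transport (κ : Measure ↥(glInt 3 F)) [IsHaarMeasure κ] (dx : Measure F)
    (μ𝔤 : Measure (Matrix (Fin 3) (Fin 3) F)) [μ𝔤.IsAddHaarMeasure] (C : ℝ≥0∞)
    (hball : ∀ m : Fin 5 → F, (!![m 0, m 1; m 2, m 3] : Matrix (Fin 2) (Fin 2) F).charpoly.eval (m 4) ≠ 0 →
      ∃ j₀ c₁ : ℕ, ∀ j' J : ℕ, j₀ ≤ j' → j' + c₁ ≤ J → ∀ h : Matrix (Fin 3) (Fin 3) F → ℝ≥0∞, Measurable h →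
        ∫⁻ k in {k : ↥(glInt 3 F) | ((k : GL (Fin 3) F) : Matrix (Fin 3) (Fin 3) F) 2 0 ∈ primePowBall F j' ∧
            ((k : GL (Fin 3) F) : Matrix (Fin 3) (Fin 3) F) 2 1 ∈ primePowBall F j'},
          ∫⁻ r : Fin 7 → F,
            ({X : Matrix (Fin 3) (Fin 3) F | ∀ i l, (X - !![m 0, m 1, 0; m 2, m 3, 0; 0, 0, m 4]) i l ∈ primePowBall F (J : ℤ)}).indicator h
              (((k : GL (Fin 3) F) : Matrix (Fin 3) (Fin 3) F) * !![r 0, r 1, r 2; r 3, r 4, r 5; 0, 0, r 6] *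
                ((((k : GL (Fin 3) F))⁻¹ : GL (Fin 3) F) : Matrix (Fin 3) (Fin 3) F))
            ∂(Measure.pi fun _ : Fin 7 => dx) ∂κ =
          C * ((normAbs F ((!![m 0, m 1; m 2, m 3] : Matrix (Fin 2) (Fin 2) F).charpoly.eval (m 4)))⁻¹ : ℝ≥0) *
            ∫⁻ X in {X : Matrix (Fin 3) (Fin 3) F | ∀ i l, (X - !![m 0, m 1, 0; m 2, m 3, 0; 0, 0, m 4]) i l ∈ primePowBall F (J : ℤ)}, h X ∂μ𝔤)
    (d : Fin 3 → F) (a : Fin 3) (m' : Fin 5 → F) (hm' : (!![m' 0, m' 1; m' 2, m' 3] : Matrix (Fin 2) (Fin 2) F).charpoly.eval (m' 4) ≠ 0)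
    (w : GL (Fin 3) F) (hw : w ∈ glInt 3 F)
    (hrow : ∀ (k : Matrix (Fin 3) (Fin 3) F) (l : Fin 3), ((w : Matrix (Fin 3) (Fin 3) F) * k) a l = k 2 l)
    (hconj : ∀ (X : Matrix (Fin 3) (Fin 3) F) (J : ℕ),
      (∀ i l, ((w : Matrix (Fin 3) (Fin 3) F) * X * ((w⁻¹ : GL (Fin 3) F) : Matrix (Fin 3) (Fin 3) F) - Matrix.diagonal d) i l ∈ primePowBall F (J : ℤ)) ↔
        (∀ i l, (X - !![m' 0, m' 1, 0; m' 2, m' 3, 0; 0, 0, m' 4]) i l ∈ primePowBall F (J : ℤ))) :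
    ∃ j₀ c₁ : ℕ, ∀ j' J : ℕ, j₀ ≤ j' → j' + c₁ ≤ J → ∀ h : Matrix (Fin 3) (Fin 3) F → ℝ≥0∞, Measurable h →
      ∫⁻ k in {k : ↥(glInt 3 F) | ((k : GL (Fin 3) F) : Matrix (Fin 3) (Fin 3) F) a 0 ∈ primePowBall F j' ∧
          ((k : GL (Fin 3) F) : Matrix (Fin 3) (Fin 3) F) a 1 ∈ primePowBall F j'},
        ∫⁻ r : Fin 7 → F,
          ({X : Matrix (Fin 3) (Fin 3) F | ∀ i l, (X - Matrix.diagonal d) i l ∈ primePowBall F (J : ℤ)}).indicator h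
            (((k : GL (Fin 3) F) : Matrix (Fin 3) (Fin 3) F) * !![r 0, r 1, r 2; r 3, r 4, r 5; 0, 0, r 6] *
              ((((k : GL (Fin 3) F))⁻¹ : GL (Fin 3) F) : Matrix (Fin 3) (Fin 3) F))
          ∂(Measure.pi fun _ : Fin 7 => dx) ∂κ =
        C * ((normAbs F ((!![m' 0, m' 1; m' 2, m' 3] : Matrix (Fin 2) (Fin 2) F).charpoly.eval (m' 4)))⁻¹ : ℝ≥0) *
          ∫⁻ X in {X : Matrix (Fin 3) (Fin 3) F | ∀ i l, (X - Matrix.diagonal d) i l ∈ primePowBall F (J : ℤ)}, h X ∂μ𝔤 := by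
  classical
  haveI : T2Space F := (isLocalField F).toT2Space
  haveI : IsTopologicalRing F := inferInstance
  obtain ⟨j₀, c₁, hb⟩ := hball m' hm'
  refine ⟨j₀, c₁, fun j' J hj' hJ h hh => ?_⟩
  set w' : ↥(glInt 3 F) := ⟨w, hw⟩ with hw'
  set B : Set (Matrix (Fin 3) (Fin 3) F) := {X : Matrix (Fin 3) (Fin 3) F | ∀ i l, (X - Matrix.diagonal d) i l ∈ primePowBall F (J : ℤ)} with hB
  set B' : Set (Matrix (Fin 3) (Fin 3) F) := {X : Matrix (Fin 3) (Fin 3) F | ∀ i l, (X - !![m' 0, m' 1, 0; m' 2, m' 3, 0; 0, 0, m' 4]) i l ∈ primePowBall F (J : ℤ)}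
    with hB'
  set Sa : Set ↥(glInt 3 F) := {k : ↥(glInt 3 F) | ((k : GL (Fin 3) F) : Matrix (Fin 3) (Fin 3) F) a 0 ∈ primePowBall F j' ∧
      ((k : GL (Fin 3) F) : Matrix (Fin 3) (Fin 3) F) a 1 ∈ primePowBall F j'} with hSa
  set S2 : Set ↥(glInt 3 F) := {k : ↥(glInt 3 F) | ((k : GL (Fin 3) F) : Matrix (Fin 3) (Fin 3) F) 2 0 ∈ primePowBall F j' ∧
      ((k : GL (Fin 3) F) : Matrix (Fin 3) (Fin 3) F) 2 1 ∈ primePowBall F j'} with hS2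
  have hSam : MeasurableSet Sa := measurableSet_rowLevelSet (F := F) a j'
  have hS2m : MeasurableSet S2 := measurableSet_rowLevelSet (F := F) 2 j'
  -- the transported test function `h' = h ∘ Ad(w)` and the pointwise transport of the integrand
  set h' : Matrix (Fin 3) (Fin 3) F → ℝ≥0∞ := fun Y => h ((w : Matrix (Fin 3) (Fin 3) F) * Y * ((w⁻¹ : GL (Fin 3) F) : Matrix (Fin 3) (Fin 3) F)) with hh'
  have hh'm : Measurable h' := hh.comp (K2E3GLnLieAdIntegralInvariant.continuous_conj w).measurable
  have hpt : ∀ Y : Matrix (Fin 3) (Fin 3) F,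
      B.indicator h ((w : Matrix (Fin 3) (Fin 3) F) * Y * ((w⁻¹ : GL (Fin 3) F) : Matrix (Fin 3) (Fin 3) F)) = B'.indicator h' Y := by
    intro Y
    have hiff : (w : Matrix (Fin 3) (Fin 3) F) * Y * ((w⁻¹ : GL (Fin 3) F) : Matrix (Fin 3) (Fin 3) F) ∈ B ↔ Y ∈ B' := hconj Y J
    by_cases hY : Y ∈ B'
    · rw [Set.indicator_of_mem (hiff.2 hY), Set.indicator_of_mem hY]
    · rw [Set.indicator_of_notMem (fun h1 => hY (hiff.1 h1)), Set.indicator_of_notMem hY]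
  -- (1) left translation by `w'` on `K`
  set Θ : ↥(glInt 3 F) → ℝ≥0∞ := fun k => ∫⁻ r : Fin 7 → F,
      B.indicator h (((k : GL (Fin 3) F) : Matrix (Fin 3) (Fin 3) F) * !![r 0, r 1, r 2; r 3, r 4, r 5; 0, 0, r 6] *
        ((((k : GL (Fin 3) F))⁻¹ : GL (Fin 3) F) : Matrix (Fin 3) (Fin 3) F)) ∂(Measure.pi fun _ : Fin 7 => dx) with hΘ
  have h1 : ∫⁻ k in Sa, Θ k ∂κ = ∫⁻ k, Sa.indicator Θ (w' * k) ∂κ := by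
    rw [← lintegral_indicator hSam, lintegral_mul_left_eq_self]
  -- (2) `w' k ∈ Sa ↔ k ∈ S2` and the integrand transported
  have hmemiff : ∀ k : ↥(glInt 3 F), w' * k ∈ Sa ↔ k ∈ S2 := by
    intro k
    have hc : (((w' * k : ↥(glInt 3 F)) : GL (Fin 3) F) : Matrix (Fin 3) (Fin 3) F) = (w : Matrix (Fin 3) (Fin 3) F) * ((k : GL (Fin 3) F) : Matrix (Fin 3) (Fin 3) F) := by
      rw [hw', Subgroup.coe_mul, Units.val_mul]
    simp only [hSa, hS2, Set.mem_setOf_eq, hc, hrow]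
  have hΘw : ∀ k : ↥(glInt 3 F), Θ (w' * k) = ∫⁻ r : Fin 7 → F,
      B'.indicator h' (((k : GL (Fin 3) F) : Matrix (Fin 3) (Fin 3) F) * !![r 0, r 1, r 2; r 3, r 4, r 5; 0, 0, r 6] *
        ((((k : GL (Fin 3) F))⁻¹ : GL (Fin 3) F) : Matrix (Fin 3) (Fin 3) F)) ∂(Measure.pi fun _ : Fin 7 => dx) := by
    intro k
    rw [hΘ]; dsimp only
    refine lintegral_congr fun r => ?_
    rw [← hpt]
    congr 1
    have hc : (((w' * k : ↥(glInt 3 F)) : GL (Fin 3) F)) = w * (k : GL (Fin 3) F) := by rw [hw', Subgroup.coe_mul]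
    rw [hc, _root_.mul_inv_rev, Units.val_mul, Units.val_mul]
    simp only [Matrix.mul_assoc]
  have h2 : ∫⁻ k, Sa.indicator Θ (w' * k) ∂κ = ∫⁻ k in S2, ∫⁻ r : Fin 7 → F,
      B'.indicator h' (((k : GL (Fin 3) F) : Matrix (Fin 3) (Fin 3) F) * !![r 0, r 1, r 2; r 3, r 4, r 5; 0, 0, r 6] *
        ((((k : GL (Fin 3) F))⁻¹ : GL (Fin 3) F) : Matrix (Fin 3) (Fin 3) F)) ∂(Measure.pi fun _ : Fin 7 => dx) ∂κ := by
    rw [← lintegral_indicator hS2m]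
    refine lintegral_congr fun k => ?_
    by_cases hk : k ∈ S2
    · rw [Set.indicator_of_mem ((hmemiff k).2 hk), Set.indicator_of_mem hk, hΘw]
    · rw [Set.indicator_of_notMem (fun h1 => hk ((hmemiff k).1 h1)), Set.indicator_of_notMem hk]
  -- (3) the ball piece at `m'`, (4) `Ad(w)` preserves `μ𝔤`
  have h3 := hb j' J hj' hJ h' hh'm
  have h4 : ∫⁻ X in B', h' X ∂μ𝔤 = ∫⁻ X in B, h X ∂μ𝔤 := by
    rw [← lintegral_indicator (measurableSet_subBall _ _), ← lintegral_indicator (measurableSet_subBall _ _)]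
    calc ∫⁻ X, B'.indicator h' X ∂μ𝔤
        = ∫⁻ X, B.indicator h ((w : Matrix (Fin 3) (Fin 3) F) * X * ((w⁻¹ : GL (Fin 3) F) : Matrix (Fin 3) (Fin 3) F)) ∂μ𝔤 :=
          lintegral_congr fun Y => (hpt Y).symm
      _ = ∫⁻ X, B.indicator h X ∂μ𝔤 := K2E3GLnLieAdIntegralInvariant.lintegral_comp_conj_of_mem_glInt μ𝔤 hw (B.indicator h)
  change ∫⁻ k in Sa, Θ k ∂κ = _
  rw [h1, h2, h3, h4]

end Transport

end Summit.HodgeConjecture.HodgeConjecture.Cruxes.H413.K2E3GL3ParabolicSlicePieceTransport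

end
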